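/-
Copyright: the b2b-balaban cell (near-miss cell 7), T⁴-continuum fan-out, NE7b ROUND-2 swarm `t4-ne7b-formalise-*`
(seat leaf-01), row S6 «H2d zones» of lineage t4-ne7b-p1's claim table `LEAVES-NE7b.md`.
Released under the licence of the surrounding project.
-/
import Summits.QuantumFields.BalabanUV.T4Continuum.Support.ZoneReading
import Summits.QuantumFields.BalabanUV.T4Continuum.Support.ZoneBirthExtent

/-!
# History zones: the zone map READ OFF THE BIRTH REGIONS of a genealogy, and its `ZoneReading`

Summits-side support leaf of the T⁴-continuum cell (rung (B)+1 on a FINITE torus only; NOT infinite volume, NOT the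
mass gap, NOT the Clay statement; NOT a proof of the spine estimate NE7b).  NE7b ROUND-2 swarm, row S6 (H2d) of
`t4/b2b-balaban-t4-ne7b-p1/LEAVES-NE7b.md` ∕ `SKELETON-NE7b-P1.md` §2.  [folklore] finite bookkeeping over the lineage's
OWN carriers (`T4PersistenceDictionary.Gen`, `ZoneTorus.{ZoneReading, blocks, diam, InRange, IsScale}`,
`ZoneBirthExtent.redZone`); nothing is quoted from print, nothing printed is asserted, no `[cite:]` tag, no `Prop` fact
minted (`BirthRegions` is a HYPOTHESIS SHAPE — the three laws a supplier's region data must obey — never asserted).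

WHY.  `HistorySocket.LiveHistories` prices a live genealogy `G` by `shapeZ`, whose multiplicity factor
`Kz^{#merges G}·∏ Q(wcnt G,σ,·)^p·Λ′^{partnerAges G}` is `ZoneReading.card_admZSet_le_of_reading` GIVEN a zone map with the
six reading facts `ZoneReading n L K Cb G zone`, and whose realized placement is admissible (`admZ_of_reading`) GIVEN
(p1) «root cells are cells of their root scale» and (p2) «at a merger the partners' root blocks lie in their zones».
Row S6 owes `zone`, the six facts, (p1), (p2) for `liveGen h X` (rows S1∕S3, in flight).  This file does everything
that does not depend on their shape: it builds the zone map from the ONE datum a history hands over per constituent —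
its BIRTH REGION — and proves the rest.
* §1 iterated blocking `(blocks L)^[k]`: range and membership.  §2 **`regZone L reg t X`**: the union over the births
  `b` of `X` with `b.step ≤ t` of the `(t − b.step)`-fold blocking of the birth region `reg b` (level-`b.step` block
  vectors of the cutoff-`K` torus); renewal adds nothing, merger = union, BY CONSTRUCTION.  §3 births along
  sub-structures; under `ZoneDrivers.Chrono` every birth is dated no later than the formation time.
* §4 **`BirthRegions n L K Cb G reg`**: regions in range, of diameter `≤ Cb·wtPEv b`, and the CONTACT law «at every
  merger of `G` the partners' zones share a level-`e.step` block»; **`zoneReading_of_birthRegions`**: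
  `Chrono ∧ BirthRegions ⇒ ZoneReading n L K Cb G (regZone L reg)` (`L ≥ 1`).
* §5 (p1) **`isScale_root_of_leafSteps`**, (p2) **`root_block_mem_regZone`** for ANY placement `P₀` putting each birth
  event on a cell of its own scale whose level-`b.step` block lies in its region (leaf steps ⇐ `Consistent`:
  `leafSteps_of_consistent`); **`birthCell`**: the canonical such cell `L^{b.step}·(a b)` (rows S7∕S12 may adopt it).
* §6 the consumers BY NAME, inputs plugged: **`admZ_of_birthRegions`**, **`card_admZSet_le_of_birthRegions`** — the
  zone-admissible placements number at most `Kz^{#merges G}·∏ Q^d·(L^d)^{partnerAges G}`,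
  `Kz = 2^d(C₀+2∕(1−σ²)+1)^d`, `C₀ = max Cb (1∕(1−σ²)+1)`, constants SYMBOLIC (trigger c2∕c6).
* §7 **`birthRegions_of_faceConnected`**: `inRange`∕`diam_le` DISCHARGED with `Cb = 4·2^d` when each birth region is the
  reduced cube family `redZone (n·L^{K−b.step}) (Z b)` of a non-empty FACE-CONNECTED `Z b ⊆ ℤ^d` with
  `treeLen (Z b) ≤ b.fat` (`ZoneBirthExtent.diam_redZone_le_fat`) — the index-model form of row S1's new regions; only
  the contact law remains a datum of the history.  §8 sanity, decided.

HOW ROWS S1∕S3∕S12 PLUG IN.  For `G := liveGen h X`: `reg b` := the recorded birth region of the constituent born with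
event `b` (well defined — events of a well-formed genealogy are distinct), `Chrono` from row S5, leaf steps from row
S4's `Consistent`, contact from the merger clause of `AdmissibleHistory` (partners merge when their blocked regions
meet), `P₀`∕`cellOf` := `birthCell` of a chosen block of the region.  NOT DONE HERE: that binding; walls unchanged —
(ID) G-ne7bp1g9-1 (H3, displayed), (E2)∕(R1) G-ne7bp1-1.  NE7b discharge: no date.

HONEST DEPENDENCY (cell): continuum YM on T⁴ ⇐ BetaPertH ∧ nine spine estimates (0/9 proved); BetaPertH ⇐ (D1) ∧ (D4)
∧ CAP+tail; G-an2-4 gates asym, D1 and NE2/3/4.  This file changes none of it.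
-/

open Finset
open Literature.MathematicalPhysics.QuantumFieldTheory.Balaban1983to89
open Literature.MathematicalPhysics.QuantumFieldTheory.Balaban1983to89.B13ScaleTransfer
open Literature.MathematicalPhysics.QuantumFieldTheory.Balaban1983to89.TreeLength
open T4PersistenceDictionary T4PartnerMultiplicity T4PrintedShapeBanking
open Summit.QuantumFields.BalabanUV.T4Continuum.PlacementSkeleton
open Summit.QuantumFields.BalabanUV.T4Continuum.Crowding
open Summit.QuantumFields.BalabanUV.T4Continuum.ZoneSkeleton
open Summit.QuantumFields.BalabanUV.T4Continuum.ZoneCrowd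
open Summit.QuantumFields.BalabanUV.T4Continuum.ZoneTorus

namespace Summit.QuantumFields.BalabanUV.T4Continuum.HistoryZones

noncomputable section

variable {d : ℕ}

/-! ## §1 Iterated blocking -/

/-- a zone in range `m` is in range of every `m′ ≥ m` [folklore] -/
theorem inRange_mono {m m' : ℕ} (h : m ≤ m') {S : Finset (Fin d → ℕ)} (hS : InRange m S) : InRange m' S :=
  fun u hu i => (hS u hu i).trans_le h

/-- `k` blockings by `L ≥ 1` bring the range `m·L^k` down to `m` [folklore] -/
theorem inRange_iterate_blocks {L : ℕ} (hL : 1 ≤ L) (m : ℕ) :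
    ∀ (k : ℕ) {S : Finset (Fin d → ℕ)}, InRange (m * L ^ k) S → InRange m ((blocks L)^[k] S)
  | 0, _, hS => by simpa using hS
  | k + 1, S, hS => by
      rw [Function.iterate_succ_apply']
      refine inRange_blocks hL (inRange_iterate_blocks hL (m * L) k ?_)
      simpa [pow_succ, mul_comm, mul_left_comm, mul_assoc] using hS

/-- the `k`-fold block of a member is a member of the `k`-fold blocking [folklore] -/
theorem mem_iterate_blocks (L : ℕ) {S : Finset (Fin d → ℕ)} {u : Fin d → ℕ} (hu : u ∈ S) :
    ∀ k : ℕ, (fun i => u i / L ^ k) ∈ (blocks L)^[k] S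
  | 0 => by simpa using hu
  | k + 1 => by
      rw [Function.iterate_succ_apply']
      refine mem_image.2 ⟨_, mem_iterate_blocks L hu k, ?_⟩
      funext i
      simp [blockVec, Nat.div_div_eq_div_mul, pow_succ]

/-! ## §2 The zone map read off the birth regions -/

/-- **THE ZONE OF A STRUCTURE AT STEP `t`, READ OFF ITS BIRTH REGIONS**: the union over the births `b` of `X` already
happened (`b.step ≤ t`) of the `(t − b.step)`-fold blocking of the birth region `reg b` (level-`b.step` block vectors).
[folklore] -/
def regZone (L : ℕ) (reg : PEv → Finset (Fin d → ℕ)) (t : ℕ) (X : Gen PEv) : Finset (Fin d → ℕ) :=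
  (births X).biUnion fun b => if b.step ≤ t then (blocks L)^[t - b.step] (reg b) else ∅

/-- membership in the zone [folklore] -/
theorem mem_regZone {L : ℕ} {reg : PEv → Finset (Fin d → ℕ)} {t : ℕ} {X : Gen PEv} {u : Fin d → ℕ} :
    u ∈ regZone L reg t X ↔ ∃ b ∈ births X, b.step ≤ t ∧ u ∈ (blocks L)^[t - b.step] (reg b) := by
  rw [regZone, mem_biUnion]
  refine exists_congr fun b => and_congr_right fun _ => ?_
  split_ifs with h <;> simp [h]

/-- a blocked birth region of a birth already happened lies in the zone [folklore] -/
theorem iterate_blocks_subset_regZone {L : ℕ} {reg : PEv → Finset (Fin d → ℕ)} {t : ℕ} {X : Gen PEv} {b : PEv}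
    (hb : b ∈ births X) (hbt : b.step ≤ t) : (blocks L)^[t - b.step] (reg b) ⊆ regZone L reg t X :=
  fun _ hu => mem_regZone.2 ⟨b, hb, hbt, hu⟩

/-- a renewal adds nothing [folklore] -/
@[simp] theorem regZone_renew (L : ℕ) (reg : PEv → Finset (Fin d → ℕ)) (t : ℕ) (X : Gen PEv) (e : PEv) (h : ℕ) :
    regZone L reg t (Gen.renew X e h) = regZone L reg t X := rfl

/-- a merger's zone is the union of the partners' zones [folklore] -/
theorem regZone_merge (L : ℕ) (reg : PEv → Finset (Fin d → ℕ)) (t : ℕ) (X Y : Gen PEv) (e : PEv) :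
    regZone L reg t (Gen.merge X Y e) = regZone L reg t X ∪ regZone L reg t Y := by
  simp only [regZone, births_merge, union_biUnion]

/-- the zone of a bare birth at its own step is its birth region [folklore] -/
@[simp] theorem regZone_born_self (L : ℕ) (reg : PEv → Finset (Fin d → ℕ)) (b : PEv) (j : ℕ) :
    regZone L reg b.step (Gen.born b j) = reg b := by
  simp [regZone]

/-! ## §3 Births along sub-structures; chronology dates births before the formation time -/

/-- births of a sub-structure are births of the whole [folklore] -/
theorem births_subset_of_sub : ∀ {X G : Gen PEv}, Sub X G → births X ⊆ births G
  | _, _, Sub.refl _ => subset_rfl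
  | _, _, Sub.renew _ _ hs => (births_subset_of_sub hs).trans (by rw [births_renew])
  | _, _, Sub.left B _ hs => (births_subset_of_sub hs).trans (by rw [births_merge]; exact subset_union_left)
  | _, _, Sub.right A _ hs => (births_subset_of_sub hs).trans (by rw [births_merge]; exact subset_union_right)

/-- **UNDER CHRONOLOGY EVERY BIRTH OF A STRUCTURE IS DATED NO LATER THAN ITS FORMATION TIME.** [folklore] -/
theorem step_le_ftime_of_chrono : ∀ {G : Gen PEv}, Chrono PEv.step G → ∀ b ∈ births G, b.step ≤ ftime PEv.step G
  | Gen.born b' j, _, b, hb => by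
      simp only [births_born, mem_singleton] at hb
      exact hb ▸ le_rfl
  | Gen.renew G e h, hc, b, hb => step_le_ftime_of_chrono (G := G) hc b hb
  | Gen.merge X Y e, hc, b, hb => by
      rw [births_merge] at hb
      rcases mem_union.1 hb with hb | hb
      · exact hc.2.2 b (mem_union_left _ (mem_union_left _ hb))
      · exact hc.2.2 b (mem_union_right _ (mem_union_left _ hb))

/-! ## §4 The three laws of the birth regions, and the reading -/

/-- **THE BIRTH-REGION LAWS** (hypothesis shape, inhabited by the supplier; §7 discharges the first two in the index
model): every birth region of `G` is in range of its level; has diameter `≤ Cb·wtPEv b`; and at every merger of `G` the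
zones of the two partners — their blocked birth regions — SHARE a level-`e.step` block (the partners are in contact
when they merge). [folklore] -/
structure BirthRegions (n L K : ℕ) (Cb : ℝ) (G : Gen PEv) (reg : PEv → Finset (Fin d → ℕ)) : Prop where
  /-- birth regions are level-`b.step` zones of the cutoff-`K` torus -/
  inRange : ∀ b ∈ births G, InRange (n * L ^ (K - b.step)) (reg b)
  /-- a birth region spans at most `Cb·wtPEv b` blocks -/
  diam_le : ∀ b ∈ births G, (diam (n * L ^ (K - b.step)) (reg b) : ℝ) ≤ Cb * wtPEv b
  /-- merger contact: the partners' zones share a block at the merger step -/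
  contact : ∀ (X Y : Gen PEv) (e : PEv), Sub (Gen.merge X Y e) G →
    ∃ z, z ∈ regZone L reg e.step X ∧ z ∈ regZone L reg e.step Y

/-- the zone of a sub-structure is in range of its level [folklore] -/
theorem inRange_regZone {n L K : ℕ} (hL : 1 ≤ L) {Cb : ℝ} {G : Gen PEv} {reg : PEv → Finset (Fin d → ℕ)}
    (hB : BirthRegions n L K Cb G reg) {X : Gen PEv} (hs : Sub X G) (t : ℕ) :
    InRange (n * L ^ (K - t)) (regZone L reg t X) := by
  intro u hu
  obtain ⟨b, hb, hbt, hu⟩ := mem_regZone.1 hu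
  have hr := hB.inRange b (births_subset_of_sub hs hb)
  have hle : n * L ^ (K - b.step) ≤ n * L ^ (K - t) * L ^ (t - b.step) := by
    rw [mul_assoc, ← pow_add]
    exact Nat.mul_le_mul_left _ (Nat.pow_le_pow_right hL (by omega))
  exact inRange_iterate_blocks hL (n * L ^ (K - t)) (t - b.step) (inRange_mono hle hr) u hu

/-- **THE BIRTH REGIONS GIVE THE ZONE READING.**  For `L ≥ 1`, a chronological `G` whose birth regions obey the three
laws is read by `regZone L reg`: `ZoneReading n L K Cb G (regZone L reg)`. [folklore] -/
theorem zoneReading_of_birthRegions {n L K : ℕ} (hL : 1 ≤ L) {Cb : ℝ} {G : Gen PEv} (hchr : Chrono PEv.step G)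
    {reg : PEv → Finset (Fin d → ℕ)} (hB : BirthRegions n L K Cb G reg) :
    ZoneReading n L K Cb G (regZone L reg) where
  inRange t X hs := inRange_regZone hL hB hs t
  birth b j hs := by
    rw [regZone_born_self]
    exact hB.diam_le b (births_subset_of_sub hs (by simp))
  union X Y e hs := by rw [regZone_merge]
  overlap := hB.contact
  step X t hs hft hK := by
    intro u hu
    obtain ⟨b, hb, -, hu⟩ := mem_regZone.1 hu
    have hbt : b.step ≤ t := (step_le_ftime_of_chrono (chrono_of_sub PEv.step hs hchr) b hb).trans hft
    have heq : t + 1 - b.step = (t - b.step) + 1 := by omega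
    rw [heq, Function.iterate_succ_apply'] at hu
    exact image_subset_image (iterate_blocks_subset_regZone hb hbt) hu
  renew X e h t hs := by rw [regZone_renew]

/-! ## §5 The two positional facts of the realized placement -/

/-- consistency descends to sub-structures [folklore] -/
theorem consistent_of_sub {C : T4PrintedShapeBanking.Consts} {K : ℕ} {R : ℕ → ℕ} :
    ∀ {X G : Gen PEv}, Sub X G → Consistent C K R G → Consistent C K R X
  | _, _, Sub.refl _, hc => hc
  | _, _, Sub.renew _ _ hs, hc => consistent_of_sub hs hc.1
  | _, _, Sub.left _ _ hs, hc => consistent_of_sub hs hc.1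
  | _, _, Sub.right _ _ hs, hc => consistent_of_sub hs hc.2.1

/-- **LEAF STEPS FROM `Consistent`**: every leaf `born b j` of a consistent genealogy records its birth event's step,
`b.step = j`. [folklore] -/
theorem leafSteps_of_consistent {C : T4PrintedShapeBanking.Consts} {K : ℕ} {R : ℕ → ℕ} {G : Gen PEv}
    (hc : Consistent C K R G) : ∀ (b : PEv) (j : ℕ), Sub (Gen.born b j) G → b.step = j :=
  fun _ _ hs => (consistent_of_sub hs hc).2.1

/-- with leaf steps, the root step of every sub-structure is its root's step [folklore] -/
theorem rootStep_eq_root_step {G : Gen PEv} (hG : ∀ (b : PEv) (j : ℕ), Sub (Gen.born b j) G → b.step = j) :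
    ∀ {X : Gen PEv}, Sub X G → X.rootStep = X.root.step
  | Gen.born b j, hs => (hG b j hs).symm
  | Gen.renew X e h, hs => by
      rw [Gen.rootStep_renew]
      exact rootStep_eq_root_step hG (Sub.trans (Sub.renew e h (Sub.refl X)) hs)
  | Gen.merge X Y e, hs => by
      have hX := rootStep_eq_root_step hG (Sub.trans (Sub.left Y e (Sub.refl X)) hs)
      have hY := rootStep_eq_root_step hG (Sub.trans (Sub.right X e (Sub.refl Y)) hs)
      by_cases h : X.rootStep ≤ Y.rootStep
      · rw [root_merge_of_le e h, Gen.rootStep_merge, min_eq_left h, hX]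
      · rw [root_merge_of_not_le e h, Gen.rootStep_merge, min_eq_right (not_le.1 h).le, hY]

/-- **(p1) ROOT CELLS ARE CELLS OF THEIR ROOT SCALE.**  If the realized placement puts every BIRTH event `b` of `G` on a
cell of scale `b.step`, then every sub-structure's root sits on a cell of its root scale (the binder `hscale` of
`ZoneReading.admZ_of_reading`). [folklore] -/
theorem isScale_root_of_leafSteps {n L K : ℕ} {G : Gen PEv}
    (hG : ∀ (b : PEv) (j : ℕ), Sub (Gen.born b j) G → b.step = j) {E : Finset PEv} {G' : Gen ↥E}
    (hGG : gmap Subtype.val G' = G) (P₀ : ↥E → TCell d (n * L ^ K))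
    (hP : ∀ b : ↥E, b.1 ∈ births G → IsScale L b.1.step (P₀ b)) :
    ∀ X' : Gen ↥E, Sub X' G' → IsScale L X'.rootStep (P₀ X'.root) := by
  intro X' hX'
  have hs : Sub (gmap Subtype.val X') G := hGG ▸ sub_gmap Subtype.val hX'
  have hroot : (X'.root).1 ∈ births G :=
    births_subset_of_sub hs (by simpa using root_mem_births (gmap Subtype.val X'))
  have hst : X'.rootStep = (X'.root).1.step := by
    have h := rootStep_eq_root_step hG hs
    simpa using h
  rw [hst]
  exact hP X'.root hroot

/-- the root block of a sub-structure formed by step `s` lies in its zone at `s`, when the placement puts every birth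
event's level-`b.step` block in its birth region [folklore] -/
theorem root_block_mem_regZone_of_le {n L K : ℕ} {G : Gen PEv} (hchr : Chrono PEv.step G)
    (reg : PEv → Finset (Fin d → ℕ)) {E : Finset PEv} {G' : Gen ↥E} (hGG : gmap Subtype.val G' = G)
    (P₀ : ↥E → TCell d (n * L ^ K))
    (hP : ∀ b : ↥E, b.1 ∈ births G → (fun i => (P₀ b i).val / L ^ b.1.step) ∈ reg b.1)
    {X' : Gen ↥E} (hX' : Sub X' G') {s : ℕ} (hs : ftime PEv.step (gmap Subtype.val X') ≤ s) :
    (fun i => (P₀ X'.root i).val / L ^ s) ∈ regZone L reg s (gmap Subtype.val X') := by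
  have hsub : Sub (gmap Subtype.val X') G := hGG ▸ sub_gmap Subtype.val hX'
  have hrX : (X'.root).1 ∈ births (gmap Subtype.val X') := by
    simpa using root_mem_births (gmap Subtype.val X')
  have hle : (X'.root).1.step ≤ s :=
    (step_le_ftime_of_chrono (chrono_of_sub PEv.step hsub hchr) _ hrX).trans hs
  refine mem_regZone.2 ⟨(X'.root).1, hrX, hle, ?_⟩
  have heq : (fun i => (P₀ X'.root i).val / L ^ s) =
      fun i => ((P₀ X'.root i).val / L ^ (X'.root).1.step) / L ^ (s - (X'.root).1.step) := by
    funext i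
    rw [Nat.div_div_eq_div_mul, ← pow_add, Nat.add_sub_cancel' hle]
  rw [heq]
  exact mem_iterate_blocks L (hP X'.root (births_subset_of_sub hsub hrX)) _

/-- **(p2) AT A MERGER BOTH PARTNERS' ROOT BLOCKS LIE IN THEIR ZONES** (the binder `hroot` of
`ZoneReading.admZ_of_reading`): chronology dates each partner's root birth before the merger, and the merger-level block
of a cell whose birth-level block lies in `reg root` lies in the blocked birth region. [folklore] -/
theorem root_block_mem_regZone {n L K : ℕ} {G : Gen PEv} (hchr : Chrono PEv.step G)
    (reg : PEv → Finset (Fin d → ℕ)) {E : Finset PEv} {G' : Gen ↥E} (hGG : gmap Subtype.val G' = G)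
    (P₀ : ↥E → TCell d (n * L ^ K))
    (hP : ∀ b : ↥E, b.1 ∈ births G → (fun i => (P₀ b i).val / L ^ b.1.step) ∈ reg b.1) :
    ∀ (X' Y' : Gen ↥E) (e' : ↥E), Sub (Gen.merge X' Y' e') G' →
      (fun i => (P₀ X'.root i).val / L ^ e'.1.step) ∈ regZone L reg e'.1.step (gmap Subtype.val X') ∧
      (fun i => (P₀ Y'.root i).val / L ^ e'.1.step) ∈ regZone L reg e'.1.step (gmap Subtype.val Y') := by
  intro X' Y' e' hm
  have hsub : Sub (gmap Subtype.val (Gen.merge X' Y' e')) G := hGG ▸ sub_gmap Subtype.val hm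
  have hchr' : Chrono PEv.step (Gen.merge (gmap Subtype.val X') (gmap Subtype.val Y') e'.1) :=
    chrono_of_sub PEv.step hsub hchr
  obtain ⟨hfX, hfY⟩ := ftime_le_of_chrono PEv.step hchr'
  exact ⟨root_block_mem_regZone_of_le hchr reg hGG P₀ hP (Sub.trans (Sub.left Y' e' (Sub.refl X')) hm) hfX,
    root_block_mem_regZone_of_le hchr reg hGG P₀ hP (Sub.trans (Sub.right X' e' (Sub.refl Y')) hm) hfY⟩

/-- **THE BIRTH CELL** of an event placed at the level-`b.step` block `a b` (a chosen block of its birth region): the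
fine torus cell with coordinates `L^{b.step}·(a b)_i` (reduced mod the torus side, a no-op in range). Rows S7∕S12 may
take `cellOf`∕`P₀` on birth events to be this. [folklore] -/
def birthCell (n L K : ℕ) (hN : 0 < n * L ^ K) (a : PEv → (Fin d → ℕ)) (b : PEv) : TCell d (n * L ^ K) :=
  fun i => ⟨(L ^ b.step * a b i) % (n * L ^ K), Nat.mod_lt _ hN⟩

/-- in range, the birth cell's coordinates are `L^{b.step}·(a b)_i` [folklore] -/
theorem birthCell_val {n L K : ℕ} (hN : 0 < n * L ^ K) {a : PEv → (Fin d → ℕ)} {b : PEv} (hb : b.step ≤ K)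
    (ha : ∀ i, a b i < n * L ^ (K - b.step)) (i : Fin d) : (birthCell n L K hN a b i).val = L ^ b.step * a b i := by
  show (L ^ b.step * a b i) % (n * L ^ K) = L ^ b.step * a b i
  apply Nat.mod_eq_of_lt
  rcases Nat.eq_zero_or_pos (L ^ b.step) with h0 | hpos
  · simpa [h0] using hN
  · calc L ^ b.step * a b i < L ^ b.step * (n * L ^ (K - b.step)) := mul_lt_mul_of_pos_left (ha i) hpos
      _ = n * L ^ K := by rw [mul_left_comm, ← pow_add, Nat.add_sub_cancel' hb]

/-- … so it is a cell of scale `b.step` (the shape of `hPs` below) [folklore] -/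
theorem isScale_birthCell {n L K : ℕ} (hN : 0 < n * L ^ K) {a : PEv → (Fin d → ℕ)} {b : PEv} (hb : b.step ≤ K)
    (ha : ∀ i, a b i < n * L ^ (K - b.step)) : IsScale L b.step (birthCell n L K hN a b) :=
  fun i => ⟨a b i, birthCell_val hN hb ha i⟩

/-- … and its level-`b.step` block is `a b` (so it lies in the birth region when `a b` does: the shape of `hPr` below)
[folklore] -/
theorem block_birthCell {n L K : ℕ} (hL : 1 ≤ L) (hN : 0 < n * L ^ K) {a : PEv → (Fin d → ℕ)} {b : PEv}
    (hb : b.step ≤ K) (ha : ∀ i, a b i < n * L ^ (K - b.step)) :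
    (fun i => (birthCell n L K hN a b i).val / L ^ b.step) = a b := by
  funext i
  rw [birthCell_val hN hb ha i, Nat.mul_div_cancel_left _ (pow_pos hL _)]

/-! ## §6 The two consumers, with S6's inputs plugged -/

section Consumers

open scoped Classical

/-- **THE REALIZED PLACEMENT IS ZONE-ADMISSIBLE** (`ZoneReading.admZ_of_reading` over the birth regions): for `L ≥ 1`,
`G` chronological with events of step `≤ K` and leaf steps, birth regions obeying the three laws, and a placement `P₀`
of the finite-alphabet copy `G'` that puts every birth event on a cell of its own scale whose block lies in its birth
region — `AdmZ (nearT n L K) (extR … (regZone L reg) ∘ gmap val) (step ∘ val) G' P₀`. [folklore] -/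
theorem admZ_of_birthRegions {n L K : ℕ} (hL : 1 ≤ L) {Cb : ℝ} {G : Gen PEv} (hchr : Chrono PEv.step G)
    (hK : ∀ e ∈ G.events, e.step ≤ K) (hG : ∀ (b : PEv) (j : ℕ), Sub (Gen.born b j) G → b.step = j)
    {reg : PEv → Finset (Fin d → ℕ)}
    (hB : BirthRegions n L K Cb G reg) {E : Finset PEv} {G' : Gen ↥E} (hGG : gmap Subtype.val G' = G)
    (P₀ : ↥E → TCell d (n * L ^ K)) (hPs : ∀ b : ↥E, b.1 ∈ births G → IsScale L b.1.step (P₀ b))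
    (hPr : ∀ b : ↥E, b.1 ∈ births G → (fun i => (P₀ b i).val / L ^ b.1.step) ∈ reg b.1) :
    AdmZ (nearT n L K) (fun t Z => extR n L K G (regZone L reg) t (gmap Subtype.val Z)) (PEv.step ∘ Subtype.val)
      G' P₀ :=
  admZ_of_reading hchr hK (zoneReading_of_birthRegions hL hchr hB) hGG P₀ (isScale_root_of_leafSteps hG hGG P₀ hPs)
    (root_block_mem_regZone hchr reg hGG P₀ hPr)

/-- **THE MULTIPLICITY FACTOR OF `shapeZ` FROM THE BIRTH REGIONS** (`ZoneReading.card_admZSet_le_of_reading` over the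
birth regions): the zone-admissible placements of `grestrict E G hE` with the root piece at `c` number at most
`Kz^{#merges G}·(∏_{e ∈ merges G} Q(wcnt G,σ,step e)^(d:ℝ))·(L^d)^{partnerAges step G}`, `Kz = 2^d(C₀+2∕(1−σ²)+1)^d`,
`C₀ = max Cb (1∕(1−σ²)+1)`, for every `0 ≤ σ < 1` with `1∕L ≤ σ²`. [folklore] -/
theorem card_admZSet_le_of_birthRegions (W : PEv → ℕ) (n : ℕ) {L : ℕ} (hL : 1 ≤ L) (K : ℕ) {Cb σ : ℝ}
    (hCb : 0 ≤ Cb) (h0 : 0 ≤ σ) (h1 : σ < 1) (hσL : 1 / (L : ℝ) ≤ σ ^ 2) {G : Gen PEv} (hW : G.WF W)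
    (hchr : Chrono PEv.step G) (hk0 : ∀ b ∈ births G, b.kind = 0) (hk2 : ∀ m ∈ merges G, m.kind ≠ 0)
    {reg : PEv → Finset (Fin d → ℕ)} (hB : BirthRegions n L K Cb G reg) (E : Finset PEv) (hE : G.events ⊆ E)
    (c c₀' : TCell d (n * L ^ K)) :
    ((admZSet (nearT n L K) (fun t Z => extR n L K G (regZone L reg) t (gmap Subtype.val Z))
        (PEv.step ∘ Subtype.val) (grestrict E G hE) (grestrict E G hE).root c c₀').card : ℝ) ≤
      ((2 : ℝ) ^ d * (max Cb (1 / (1 - σ ^ 2) + 1) + 2 * (1 / (1 - σ ^ 2)) + 1) ^ d) ^ (merges G).card *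
        (∏ e ∈ merges G, Q (wcnt G) σ e.step ^ (d : ℝ)) * ((L : ℝ) ^ d) ^ partnerAges PEv.step G :=
  card_admZSet_le_of_reading W n hL K hCb h0 h1 hσL hW hchr hk0 hk2 (zoneReading_of_birthRegions hL hchr hB) E hE c c₀'

end Consumers

/-! ## §7 The index-model form: birth regions as reduced face-connected cube families -/

/-- the weight of a kind-`0` event is its fatness plus one [folklore] -/
theorem wtPEv_of_kind0 {b : PEv} (hb : b.kind = 0) : wtPEv b = (b.fat : ℝ) + 1 := by
  simp [wtPEv, hb]

/-- **THE LAWS `inRange`∕`diam_le` DISCHARGED IN THE INDEX MODEL, `Cb = 4·2^d`.**  If every birth `b` of `G` is a kind-`0`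
event whose region is the reduced cube family `redZone (n·L^{K−b.step}) (Z b)` of a non-empty face-connected
`Z b ⊆ ℤ^d` of tree length `≤ b.fat`, and the contact law holds, then `BirthRegions n L K (4·2^d) G reg`
(`ZoneBirthExtent.diam_redZone_le_fat`; `n ≥ 1`, `L ≥ 1`). [folklore] -/
theorem birthRegions_of_faceConnected {n L K : ℕ} (hn : 1 ≤ n) (hL : 1 ≤ L) {G : Gen PEv}
    (Z : PEv → Finset (Pt d)) (hne : ∀ b ∈ births G, (Z b).Nonempty)
    (hfc : ∀ b ∈ births G, FaceConnected (Z b)) (hfat : ∀ b ∈ births G, treeLen (Z b) ≤ b.fat)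
    (hk0 : ∀ b ∈ births G, b.kind = 0)
    (hcontact : ∀ (X Y : Gen PEv) (e : PEv), Sub (Gen.merge X Y e) G →
      ∃ z, z ∈ regZone L (fun b => redZone (n * L ^ (K - b.step)) (Z b)) e.step X ∧
        z ∈ regZone L (fun b => redZone (n * L ^ (K - b.step)) (Z b)) e.step Y) :
    BirthRegions n L K (4 * 2 ^ d) G (fun b => redZone (n * L ^ (K - b.step)) (Z b)) where
  inRange b _ := inRange_redZone (Nat.mul_pos hn (pow_pos hL _)) (Z b)
  diam_le b hb := by
    rw [wtPEv_of_kind0 (hk0 b hb)]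
    exact diam_redZone_le_fat (Nat.mul_pos hn (pow_pos hL _)) (hne b hb) (hfc b hb) (hfat b hb)
  contact := hcontact

/-! ## §8 Sanity (decided toy instances) -/

namespace Sanity

/-- toy birth regions on the `d = 1` torus: event `(0,0,1)` (birth at step `0`, fatness `1`) ↦ blocks `{4, 5}`;
event `(1,0,0)` ↦ block `{2}`; everything else empty -/
def regT : PEv → Finset (Fin 1 → ℕ) := fun b =>
  if b = (0, 0, 1) then {![4], ![5]} else if b = (1, 0, 0) then {![2]} else ∅

/-- the merger at step `1` of the two births: after one blocking by `L = 2` the first region is `{2}`, which IS the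
second region — contact -/
def GT : Gen PEv := Gen.merge (Gen.born (0, 0, 1) 0) (Gen.born (1, 0, 0) 1) (1, 2, 0)

/-- the zone of the merged structure at step `1` is `{2}` (union of `blocks 2 {4,5} = {2}` and `{2}`) -/
example : regZone 2 regT 1 GT = {![2]} := by decide

/-- at step `0` only the first birth has happened: zone `{4, 5}` -/
example : regZone 2 regT 0 GT = {![4], ![5]} := by decide

end Sanity

end

end Summit.QuantumFields.BalabanUV.T4Continuum.HistoryZones
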